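import Mathlib.Analysis.SpecialFunctions.Complex.CircleAddChar
import Mathlib.Analysis.SpecialFunctions.Trigonometric.Bounds
import Mathlib.Analysis.Complex.Trigonometric
import Mathlib.Algebra.Field.GeomSum
import Mathlib.Data.Matrix.Mul
import HarnessLib

/-!
# Chen–Liu–Zhandry 2022: quantum «filtering» algorithms for SIS^∞, EDCP and LWE-like states — the printed regimes

Y. Chen, Q. Liu, M. Zhandry, *Quantum algorithms for variants of average-case lattice problems via filtering*,
EUROCRYPT 2022 (arXiv:2108.11015) [ChenLiuZhandry2021]. The paper gives polynomial-time QUANTUM algorithms for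
three average-case lattice problems in SPECIAL parameter regimes:

* **Thm 2** (p. 5): `SIS^∞_{n,m,q,(q−c)/2}` for a constant `c`, a polynomially large PRIME `q > c`, and
  `m ∈ Ω((q−c)³ · n^c · q · log q) ⊆ poly(n)` samples (Remark 3: `β = q/2` is classical Gaussian elimination);
* **Thm 5** (p. 5): `EDCP_{n,m,q,D}` with `D` uniform on `[0, q−c) ∩ ℤ`, same `m`;
* **Thm 9** (p. 6): the quantum-state problems `LWEstate_{n,m,q,f}` (Def 7) and `QLWE_{n,m,q,f}` (Def 8) — the error
  distribution sits in the AMPLITUDE `f : ℤ_q → ℝ` of a quantum state, NOT in classical samples — whenever the state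
  `Σ_e f(e)|e⟩` is efficiently constructible, `η := min_{y ∈ ℤ_q} |f̂(y)|` is non-negligible, and `m ∈ Ω(n·q/η²)`;
  **Cor 10** (p. 7; = Cor 39 p. 21 with proof): the bounded-uniform amplitude on `[−B, B]`, `0 < 2B+1 < q`,
  `gcd(2B+1, q) = 1`, `m ∈ Ω(n · q⁴ · (2B+1))`; **Thm 11**: `f̂` = DFT of bounded uniform, `q − (2B+1) = c` constant.

The printed scope sentences (p. 5–6): «our algorithm does not improve upon the existing algorithms for breaking the
signature scheme in [DKL+18] since we require m to be very large»; EDCP «with such parameter settings are not known to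
be as hard as worst-case SVP or LWE»; «solving LWEstate or QLWE does not necessarily imply solving LWE in general».

This file types the printed OBJECTS (the `q`-DFT `f̂`, `η`, the bounded-uniform amplitude, the LWE-like state
amplitudes of Def 7/8, the sample-growth functions of Thm 2/5/11, Thm 9, Cor 10 with their side conditions) as
definitions, and PROVES the one computation the paper performs to get Cor 10 from Thm 9 (proof of Cor 39, p. 21):
the Dirichlet-kernel bound `|f̂(y)| ≥ sin(π/q)/√(q(2B+1)) ≥ (1/q)·√(1/(q(2B+1)))` for `y ≠ 0` when `gcd(2B+1, q) = 1`,
`f̂(0) = √((2B+1)/q)`, hence `η ≥ (1/q)·√(1/(q(2B+1)))` and `n·q/η² ≤ n·q⁴·(2B+1)`. The existence of the quantum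
algorithms themselves (Thm 2/5/9) is NOT asserted here (no named fact): the tree's circuit vocabulary for LWE-like
STATE inputs is the subject of `ChenQuantumLWE*.lean` / `DihedralCosetProblem.lean`, and a line that wants the
algorithmic statements takes them as cited hypotheses. All `Ω(·)` are rendered by the growth function alone (the
paper's implicit constants are not printed).

What this typing does NOT say: nothing here is a statement about ML-KEM or ML-DSA (FIPS 203/204) — their instances
expose classical (M)LWE samples with `m ≤ 2n` and centered-binomial / uniform-`η` errors, and whether such parameters
meet or miss the printed regimes is an «at P» display that belongs to a cell line under `Summits/Ventures/PQCSecurity/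
QALWE/` (ruling H1), not to this file; no sentence here places any scheme inside or outside a CLZ22 regime, and the
paper itself prints that the algorithms need «m to be very large» (p. 5).

## References
* [ChenLiuZhandry2021] Y. Chen, Q. Liu, M. Zhandry, EUROCRYPT 2022, LNCS 13277, 372–401; arXiv:2108.11015 (pages cited
  are arXiv pages, read via `lit read arxiv:2108.11015`).
-/

namespace Literature.Computability.Cryptography

namespace CLZ22

open scoped Real
open Finset

/-! ### The printed objects -/

/-- The discrete Fourier transform over `ℤ_q` as printed: `f̂(y) := Σ_{x ∈ ℤ_q} (1/√q) · e^{2πi·xy/q} · f(x)`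
(Mathlib's standard additive character `stdAddChar (x·y) = e^{2πi·xy/q}`). [cite: ChenLiuZhandry2021, §1.1 p. 6 (display before Thm 9)] -/
noncomputable def qdft (q : ℕ) [NeZero q] (f : ZMod q → ℝ) (y : ZMod q) : ℂ :=
  ∑ x : ZMod q, ((1 / Real.sqrt q : ℝ) : ℂ) * ZMod.stdAddChar (x * y) * (f x : ℂ)

/-- `η := min_{y ∈ ℤ_q} |f̂(y)|`, the quantity that must be non-negligible in Thm 9. [cite: ChenLiuZhandry2021, Thm 9] -/
noncomputable def eta (q : ℕ) [NeZero q] (f : ZMod q → ℝ) : ℝ :=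
  Finset.univ.inf' Finset.univ_nonempty fun y : ZMod q => ‖qdft q f y‖

/-- The residues of the integer window `[−B, B]`, presented as `{(k − B) mod q : k < 2B+1}`.
[cite: ChenLiuZhandry2021, Cor 10 («x ∈ [−B, B] ∩ ℤ»)] -/
def window (q B : ℕ) : Finset (ZMod q) :=
  (Finset.range (2 * B + 1)).image fun k : ℕ => (((k : ℤ) - B : ℤ) : ZMod q)

/-- The bounded-uniform error AMPLITUDE of Cor 10: `f(x) := 1/√(2B+1)` for `x ∈ [−B, B] ∩ ℤ` and `0` elsewhere.
[cite: ChenLiuZhandry2021, Cor 10] -/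
noncomputable def boundedUniformAmp (q B : ℕ) (x : ZMod q) : ℝ :=
  if x ∈ window q B then 1 / Real.sqrt (2 * B + 1) else 0

/-- The EDCP amplitude window of Thm 5: `D` uniform on `[0, q−c) ∩ ℤ` (indicator; the state is a ray, so the
normalisation is immaterial). [cite: ChenLiuZhandry2021, Thm 5] -/
def thm5Window (q c : ℕ) (j : ZMod q) : ℝ :=
  if j.val < q - c then 1 else 0

/-- Def 8 (`QLWE_{n,m,q,f}`, «solving LWE given LWE-like states»): the `i`-th sample is `a_i` together with the STATE
`Σ_{e ∈ ℤ_q} f(e) |a_i·u + e mod q⟩`; its amplitude at the basis vector `|z⟩` is `f(z − a_i·u)`.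
[cite: ChenLiuZhandry2021, Def 8] -/
def qlweAmp {q n : ℕ} (f : ZMod q → ℝ) (a u : Fin n → ZMod q) (z : ZMod q) : ℝ :=
  f (z - a ⬝ᵥ u)

/-- Def 7 (`LWEstate_{n,m,q,f}`, «constructing LWE states»): the target state
`Σ_{u ∈ ℤ_q^n} ⊗_{i=1}^m (Σ_{e_i} f(e_i) |a_i·u + e_i mod q⟩)` (unnormalised, as printed); its amplitude at
`|z_1, …, z_m⟩` is `Σ_u Π_i f(z_i − a_i·u)`. There is NO secret here: the goal is the uniform superposition over all
`u`. [cite: ChenLiuZhandry2021, Def 7] -/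
noncomputable def lweStateAmp {q n m : ℕ} [NeZero q] (f : ZMod q → ℝ) (A : Fin m → Fin n → ZMod q) (z : Fin m → ZMod q) : ℝ :=
  ∑ u : Fin n → ZMod q, ∏ i, f (z i - A i ⬝ᵥ u)

/-- The `ℓ_∞` bound of Thm 2: `β = (q − c)/2`. [cite: ChenLiuZhandry2021, Thm 2] -/
noncomputable def thm2NormBound (q c : ℕ) : ℝ := ((q : ℝ) - c) / 2

/-- The sample-growth function of Thm 2, Thm 5 and Thm 11: `m ∈ Ω((q − c)³ · n^c · q · log q)`.
[cite: ChenLiuZhandry2021, Thm 2, Thm 5, Thm 11] -/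
noncomputable def thm2SampleGrowth (c n q : ℕ) : ℝ := ((q : ℝ) - c) ^ 3 * (n : ℝ) ^ c * q * Real.log q

/-- The sample-growth function of Thm 9: `m ∈ Ω(n · q / η²)`. [cite: ChenLiuZhandry2021, Thm 9] -/
noncomputable def thm9SampleGrowth (n q : ℕ) (η : ℝ) : ℝ := (n : ℝ) * q / η ^ 2

/-- The sample-growth function of Cor 10: `m ∈ Ω(n · q⁴ · (2B+1))`. [cite: ChenLiuZhandry2021, Cor 10] -/
noncomputable def cor10SampleGrowth (n q B : ℕ) : ℝ := (n : ℝ) * (q : ℝ) ^ 4 * (2 * B + 1)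

/-- The side conditions of Thm 2: `c > 0` constant, `q > c` prime. [cite: ChenLiuZhandry2021, Thm 2] -/
structure Thm2Conditions (q c : ℕ) : Prop where
  c_pos : 0 < c
  c_lt : c < q
  prime : Nat.Prime q

/-- The side conditions of Cor 10: `0 < 2B+1 < q` and `gcd(2B+1, q) = 1` (Remark 40: for `gcd > 1` the DFT vanishes at
`q/v − 1` points and «it is not clear to us how to extend our algorithm»). [cite: ChenLiuZhandry2021, Cor 10, Remark 40] -/
structure Cor10Conditions (q B : ℕ) : Prop where
  lt : 2 * B + 1 < q
  coprime : Nat.Coprime (2 * B + 1) q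

/-- The eta bound extracted in the proof of Cor 39: `η ≥ √(1/(q(2B+1))) · (1/q)`.
[cite: ChenLiuZhandry2021, Cor 39 (proof, p. 21)] -/
noncomputable def cor39EtaBound (q B : ℕ) : ℝ := Real.sqrt (1 / ((q : ℝ) * (2 * B + 1))) * (1 / q)

/-! ### Elementary lemmas about the window -/

/-- Unfolding of `qlweAmp`. [cite: ChenLiuZhandry2021, Def 8] -/
theorem qlweAmp_apply {q n : ℕ} (f : ZMod q → ℝ) (a u : Fin n → ZMod q) (z : ZMod q) :
    qlweAmp f a u z = f (z - a ⬝ᵥ u) := rfl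

/-- The LWE-like state of a sample puts amplitude `f(e)` on `|a·u + e⟩`. [cite: ChenLiuZhandry2021, Def 8] -/
theorem qlweAmp_shift {q n : ℕ} (f : ZMod q → ℝ) (a u : Fin n → ZMod q) (e : ZMod q) :
    qlweAmp f a u (a ⬝ᵥ u + e) = f e := by
  simp [qlweAmp]

/-- Membership in the window: `x ≡ j (mod q)` for some integer `j ∈ [−B, B]`. [cite: ChenLiuZhandry2021, Cor 10] -/
theorem mem_window_iff {q B : ℕ} (x : ZMod q) :
    x ∈ window q B ↔ ∃ j : ℤ, -(B : ℤ) ≤ j ∧ j ≤ B ∧ (j : ZMod q) = x := by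
  unfold window
  simp only [Finset.mem_image, Finset.mem_range]
  constructor
  · rintro ⟨k, hk, rfl⟩
    exact ⟨(k : ℤ) - B, by omega, by omega, rfl⟩
  · rintro ⟨j, hj1, hj2, rfl⟩
    refine ⟨(j + B).toNat, by omega, ?_⟩
    have : (((j + B).toNat : ℕ) : ℤ) = j + B := Int.toNat_of_nonneg (by omega)
    rw [this]
    push_cast
    ring_nf

/-- For `2B+1 ≤ q` the residues of `[−B, B]` are distinct. [cite: ChenLiuZhandry2021, Cor 10 («2B+1 < q»)] -/
theorem window_injOn {q B : ℕ} (h : 2 * B + 1 ≤ q) :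
    Set.InjOn (fun k : ℕ => (((k : ℤ) - B : ℤ) : ZMod q)) (Finset.range (2 * B + 1) : Set ℕ) := by
  intro k₁ hk₁ k₂ hk₂ hk
  simp only [Finset.coe_range, Set.mem_Iio] at hk₁ hk₂
  have hk' : ((k₁ : ℤ) : ZMod q) = ((k₂ : ℤ) : ZMod q) := by
    have := congrArg (fun z : ZMod q => z + (B : ℤ)) hk
    simpa using this
  push_cast at hk'
  rw [ZMod.natCast_eq_natCast_iff'] at hk'
  rwa [Nat.mod_eq_of_lt (by omega), Nat.mod_eq_of_lt (by omega)] at hk'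

/-- The window has `2B+1` residues when `2B+1 ≤ q`. [cite: ChenLiuZhandry2021, Cor 10] -/
theorem card_window {q B : ℕ} (h : 2 * B + 1 ≤ q) : (window q B).card = 2 * B + 1 := by
  unfold window
  rw [Finset.card_image_of_injOn (window_injOn h), Finset.card_range]

/-- The amplitude is the printed constant on the window. [cite: ChenLiuZhandry2021, Cor 10] -/
theorem boundedUniformAmp_of_mem {q B : ℕ} {x : ZMod q} (hx : x ∈ window q B) :
    boundedUniformAmp q B x = 1 / Real.sqrt (2 * B + 1) := by
  simp [boundedUniformAmp, hx]

/-- The amplitude vanishes off the window. [cite: ChenLiuZhandry2021, Cor 10] -/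
theorem boundedUniformAmp_of_not_mem {q B : ℕ} {x : ZMod q} (hx : x ∉ window q B) :
    boundedUniformAmp q B x = 0 := by
  simp [boundedUniformAmp, hx]

/-- The bounded-uniform amplitude is a unit vector: `Σ_x f(x)² = 1` (for `2B+1 ≤ q`). [cite: ChenLiuZhandry2021, Cor 10] -/
theorem boundedUniformAmp_normSq {q B : ℕ} [NeZero q] (h : 2 * B + 1 ≤ q) :
    ∑ x : ZMod q, boundedUniformAmp q B x ^ 2 = 1 := by
  have hsplit : ∑ x : ZMod q, boundedUniformAmp q B x ^ 2 =
      ∑ x ∈ window q B, boundedUniformAmp q B x ^ 2 := by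
    refine (Finset.sum_subset (Finset.subset_univ _) fun x _ hx => ?_).symm
    rw [boundedUniformAmp_of_not_mem hx]; ring
  rw [hsplit, Finset.sum_congr rfl fun x hx => by rw [boundedUniformAmp_of_mem hx], Finset.sum_const, card_window h]
  have h0 : (0 : ℝ) < 2 * B + 1 := by positivity
  rw [nsmul_eq_mul, div_pow, one_pow, Real.sq_sqrt h0.le]
  push_cast
  field_simp

/-! ### The DFT of the bounded-uniform amplitude (proof of Cor 39) -/

section DFT

variable {q : ℕ} [NeZero q]

/-- The DFT sum of the bounded-uniform amplitude runs over the window only: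
`f̂(y) = (1/√q)(1/√(2B+1)) · Σ_{k<2B+1} e^{2πi (k−B) y / q}`. [cite: ChenLiuZhandry2021, Cor 39 (proof, first display)] -/
theorem qdft_boundedUniformAmp_eq {B : ℕ} (h : 2 * B + 1 ≤ q) (y : ZMod q) :
    qdft q (boundedUniformAmp q B) y =
      ((1 / Real.sqrt q : ℝ) : ℂ) * ((1 / Real.sqrt (2 * B + 1) : ℝ) : ℂ) *
        ∑ k ∈ Finset.range (2 * B + 1), (ZMod.stdAddChar ((((k : ℤ) - B : ℤ) : ZMod q) * y) : ℂ) := by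
  unfold qdft
  have hsplit : ∑ x : ZMod q, ((1 / Real.sqrt q : ℝ) : ℂ) * ZMod.stdAddChar (x * y) * (boundedUniformAmp q B x : ℂ) =
      ∑ x ∈ window q B, ((1 / Real.sqrt q : ℝ) : ℂ) * ZMod.stdAddChar (x * y) * (boundedUniformAmp q B x : ℂ) := by
    refine (Finset.sum_subset (Finset.subset_univ _) fun x _ hx => ?_).symm
    rw [boundedUniformAmp_of_not_mem hx]; simp
  rw [hsplit, Finset.sum_congr rfl fun x hx => by rw [boundedUniformAmp_of_mem hx]]
  unfold window
  rw [Finset.sum_image (window_injOn h), Finset.mul_sum]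
  refine Finset.sum_congr rfl fun k _ => ?_
  ring

/-- At `y = 0`: `f̂(0) = √((2B+1)/q)` (printed «when y = 0, f̂(y) = √((2B+1)/q)»), here as `√(2B+1)/√q`.
[cite: ChenLiuZhandry2021, Cor 39 (proof)] -/
theorem qdft_boundedUniformAmp_zero {B : ℕ} (h : 2 * B + 1 ≤ q) :
    qdft q (boundedUniformAmp q B) 0 = ((Real.sqrt (2 * B + 1) / Real.sqrt q : ℝ) : ℂ) := by
  rw [qdft_boundedUniformAmp_eq h]
  simp only [mul_zero, AddChar.map_zero_eq_one, Finset.sum_const, Finset.card_range, nsmul_eq_mul, mul_one]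
  have h0 : (0 : ℝ) < 2 * B + 1 := by positivity
  have hs : Real.sqrt (2 * B + 1) ≠ 0 := (Real.sqrt_pos.mpr h0).ne'
  have key : (1 / Real.sqrt (2 * B + 1) : ℝ) * (2 * B + 1) = Real.sqrt (2 * B + 1) := by
    rw [div_mul_eq_mul_div, one_mul, div_eq_iff hs, ← pow_two, Real.sq_sqrt h0.le]
  have : ((1 / Real.sqrt q : ℝ) : ℂ) * ((1 / Real.sqrt (2 * B + 1) : ℝ) : ℂ) * ((2 * B + 1 : ℕ) : ℂ) =
      (((1 / Real.sqrt q) * ((1 / Real.sqrt (2 * B + 1)) * (2 * B + 1)) : ℝ) : ℂ) := by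
    push_cast; ring
  rw [this, key]
  push_cast
  ring

/-- **The sine floor** behind «the numerator satisfies |sin(2π/q · (2B+1)/2 · y)| ≥ |sin(π/q)|»: for an integer `m`
NOT divisible by `q ≥ 2`, `sin(π/q) ≤ |sin(π m / q)|` (reduce `m` mod `q` to `r ∈ [1, q−1]`, so `π r/q ∈ [π/q, π − π/q]`).
[cite: ChenLiuZhandry2021, Cor 39 (proof)] -/
theorem sin_pi_div_le_abs_sin {q : ℕ} (hq : 2 ≤ q) {m : ℤ} (hm : ¬ (q : ℤ) ∣ m) :
    Real.sin (π / q) ≤ |Real.sin (π * m / q)| := by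
  have hq0 : (0 : ℝ) < q := by exact_mod_cast (by omega : 0 < q)
  have hqz : (0 : ℤ) < q := by exact_mod_cast (by omega : 0 < q)
  set r : ℤ := m % q with hr
  set k : ℤ := m / q with hk
  have hdecomp : (m : ℝ) = q * k + r := by
    have := Int.mul_ediv_add_emod m q
    exact_mod_cast this.symm
  have hr0 : 0 ≤ r := Int.emod_nonneg _ (by omega)
  have hrq : r < q := Int.emod_lt_of_pos _ hqz
  have hrne : r ≠ 0 := fun h0 => hm (Int.dvd_of_emod_eq_zero h0)
  have hr1 : 1 ≤ r := by omega
  have hrq' : r ≤ q - 1 := by omega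
  -- `π m / q = π r / q + k π`
  have hangle : π * m / q = π * r / q + k * π := by
    rw [hdecomp]; field_simp; ring
  rw [hangle, Real.sin_add_int_mul_pi, abs_mul, abs_neg_one_zpow, one_mul]
  -- now `x := π r / q ∈ [π/q, π − π/q]`
  have hx1 : π / q ≤ π * r / q := by
    rw [div_le_div_iff_of_pos_right hq0]
    have : (1 : ℝ) ≤ r := by exact_mod_cast hr1
    nlinarith [Real.pi_pos]
  have hx2 : π * r / q ≤ π - π / q := by
    have : (r : ℝ) ≤ q - 1 := by
      have := hrq'; exact_mod_cast (by omega : r ≤ (q : ℤ) - 1)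
    rw [le_sub_iff_add_le, ← add_div, div_le_iff₀ hq0]
    nlinarith [Real.pi_pos]
  have hpq2 : π / q ≤ π / 2 := by
    apply div_le_div_of_nonneg_left Real.pi_pos.le (by norm_num)
    exact_mod_cast hq
  have hpq0 : -(π / 2) ≤ π / q := by
    have : 0 ≤ π / q := div_nonneg Real.pi_pos.le hq0.le
    linarith [Real.pi_pos]
  refine le_trans ?_ (le_abs_self _)
  by_cases hcase : π * r / q ≤ π / 2
  · exact Real.sin_le_sin_of_le_of_le_pi_div_two hpq0 hcase hx1
  · rw [not_le] at hcase
    rw [← Real.sin_pi_sub (π * r / q)]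
    exact Real.sin_le_sin_of_le_of_le_pi_div_two hpq0 (by linarith) (by linarith)

/-- `0 < sin(π/q)` for `q ≥ 2`. [cite: ChenLiuZhandry2021, Cor 39 (proof, «|sin(π/q)| > 1/q»)] -/
theorem sin_pi_div_pos {q : ℕ} (hq : 2 ≤ q) : 0 < Real.sin (π / q) := by
  have hq0 : (0 : ℝ) < q := by exact_mod_cast (by omega : 0 < q)
  apply Real.sin_pos_of_pos_of_lt_pi (div_pos Real.pi_pos hq0)
  rw [div_lt_iff₀ hq0]
  have : (2 : ℝ) ≤ q := by exact_mod_cast hq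
  nlinarith [Real.pi_pos]

/-- Jordan's inequality at `π/q`: `2/q ≤ sin(π/q)` (`q ≥ 2`), which gives the printed `|sin(π/q)| > 1/q`.
[cite: ChenLiuZhandry2021, Cor 39 (proof)] -/
theorem two_div_le_sin_pi_div {q : ℕ} (hq : 2 ≤ q) : (2 : ℝ) / q ≤ Real.sin (π / q) := by
  have hq0 : (0 : ℝ) < q := by exact_mod_cast (by omega : 0 < q)
  have h2q : (2 : ℝ) / q ≤ 1 := by
    rw [div_le_one hq0]; exact_mod_cast hq
  have := Real.le_sin_mul (by positivity) h2q
  have harg : π / 2 * (2 / q) = π / q := by field_simp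
  rwa [harg] at this

/-- The printed strict form `|sin(π/q)| > 1/q`. [cite: ChenLiuZhandry2021, Cor 39 (proof)] -/
theorem one_div_lt_sin_pi_div {q : ℕ} (hq : 2 ≤ q) : (1 : ℝ) / q < Real.sin (π / q) := by
  have hq0 : (0 : ℝ) < q := by exact_mod_cast (by omega : 0 < q)
  have : (1 : ℝ) / q < 2 / q := by
    rw [div_lt_div_iff_of_pos_right hq0]; norm_num
  exact lt_of_lt_of_le this (two_div_le_sin_pi_div hq)

/-- **Dirichlet kernel, lower bound.** For `t : ℤ` with `q ∤ t` and `q ∤ (2B+1)·t`: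
`‖Σ_{k<2B+1} e^{2πi (k−B) t/q}‖ = |sin(π(2B+1)t/q)| / |sin(π t/q)| ≥ sin(π/q)`.
[cite: ChenLiuZhandry2021, Cor 39 (proof: «1 + 2cos x + ⋯ + 2cos nx = sin((n+½)x)/sin(x/2)», numerator
`≥ |sin(π/q)|`, denominator `≤ 1`)] -/
theorem sin_pi_div_le_norm_windowSum {q : ℕ} [NeZero q] (hq : 2 ≤ q) {B : ℕ} {t : ℤ}
    (ht : ¬ (q : ℤ) ∣ t) (hBt : ¬ (q : ℤ) ∣ (2 * B + 1 : ℕ) * t) :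
    Real.sin (π / q) ≤ ‖∑ k ∈ Finset.range (2 * B + 1),
      (ZMod.stdAddChar ((((k : ℤ) - B : ℤ) : ZMod q) * (t : ZMod q)) : ℂ)‖ := by
  have hq0 : (0 : ℝ) < q := by exact_mod_cast (by omega : 0 < q)
  -- the phase `θ = 2π t / q` and the ratio `r = e^{iθ}`
  set θ : ℝ := 2 * π * t / q with hθ
  set r : ℂ := Complex.exp (Complex.I * θ) with hr
  -- each term is `e^{-iBθ} · r^k`
  have hterm : ∀ k : ℕ, (ZMod.stdAddChar ((((k : ℤ) - B : ℤ) : ZMod q) * (t : ZMod q)) : ℂ) =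
      Complex.exp (Complex.I * (-(B : ℝ) * θ)) * r ^ k := by
    intro k
    have hcast : ((((k : ℤ) - B : ℤ) : ZMod q) * (t : ZMod q)) = ((((k : ℤ) - B) * t : ℤ) : ZMod q) := by
      push_cast; ring
    rw [hcast, ZMod.stdAddChar_coe, hr, ← Complex.exp_nat_mul, ← Complex.exp_add]
    congr 1
    push_cast
    rw [hθ]
    push_cast
    field_simp
    ring
  rw [Finset.sum_congr rfl fun k _ => hterm k, ← Finset.mul_sum, norm_mul]
  have hphase : ‖Complex.exp (Complex.I * (-(B : ℝ) * θ))‖ = 1 := by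
    rw [show Complex.I * (-(B : ℝ) * θ) = ((-(B : ℝ) * θ : ℝ) : ℂ) * Complex.I by push_cast; ring]
    exact Complex.norm_exp_ofReal_mul_I _
  rw [hphase, one_mul]
  -- `r ≠ 1` because `sin(θ/2) = sin(π t/q) ≠ 0`
  have hsin_t : Real.sin (π / q) ≤ |Real.sin (π * t / q)| := sin_pi_div_le_abs_sin hq ht
  have hpos := sin_pi_div_pos hq
  have hθ2 : θ / 2 = π * t / q := by rw [hθ]; ring
  have hr1 : r ≠ 1 := by
    intro h1
    have : ‖r - 1‖ = 0 := by rw [h1, sub_self, norm_zero]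
    rw [hr, Complex.norm_exp_I_mul_ofReal_sub_one, hθ2, Real.norm_eq_abs, abs_mul] at this
    have h2 : |Real.sin (π * t / q)| = 0 := by
      rcases mul_eq_zero.mp this with h | h
      · norm_num at h
      · exact h
    linarith
  rw [geom_sum_eq hr1, norm_div]
  -- numerator and denominator via `‖e^{ix} − 1‖ = 2|sin(x/2)|`
  have hnum : ‖r ^ (2 * B + 1) - 1‖ = 2 * |Real.sin (π * ((2 * B + 1 : ℕ) * t : ℤ) / q)| := by
    rw [hr, ← Complex.exp_nat_mul, show ((2 * B + 1 : ℕ) : ℂ) * (Complex.I * θ) =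
      Complex.I * (((2 * B + 1 : ℕ) * θ : ℝ) : ℂ) by push_cast; ring, Complex.norm_exp_I_mul_ofReal_sub_one,
      Real.norm_eq_abs, abs_mul, abs_two]
    congr 2
    rw [hθ]; push_cast; ring
  have hden : ‖r - 1‖ = 2 * |Real.sin (π * t / q)| := by
    rw [hr, Complex.norm_exp_I_mul_ofReal_sub_one, hθ2, Real.norm_eq_abs, abs_mul, abs_two]
  rw [hnum, hden]
  have hnum_ge : Real.sin (π / q) ≤ |Real.sin (π * ((2 * B + 1 : ℕ) * t : ℤ) / q)| :=
    sin_pi_div_le_abs_sin hq hBt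
  have hden_le : |Real.sin (π * t / q)| ≤ 1 := Real.abs_sin_le_one _
  have hden_pos : 0 < |Real.sin (π * t / q)| := lt_of_lt_of_le hpos hsin_t
  rw [le_div_iff₀ (by positivity)]
  nlinarith

/-- **Cor 39, the DFT floor off zero**: for `y ≠ 0` and `gcd(2B+1, q) = 1`, `2B+1 < q`:
`|f̂(y)| ≥ sin(π/q) · (1/√q) · (1/√(2B+1))`. [cite: ChenLiuZhandry2021, Cor 39 (proof)] -/
theorem norm_qdft_boundedUniformAmp_ge {B : ℕ} (hc : Cor10Conditions q B) {y : ZMod q} (hy : y ≠ 0) :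
    Real.sin (π / q) * ((1 / Real.sqrt q) * (1 / Real.sqrt (2 * B + 1))) ≤ ‖qdft q (boundedUniformAmp q B) y‖ := by
  have hq : 2 ≤ q := by have := hc.lt; omega
  -- lift `y` to the integer `t = y.val ∈ [1, q−1]`
  set t : ℤ := (y.val : ℤ) with ht
  have hyt : (t : ZMod q) = y := by rw [ht]; push_cast; exact ZMod.natCast_zmod_val y
  have htq : ¬ (q : ℤ) ∣ t := by
    rw [ht]
    intro hdvd
    have h1 : (q : ℤ) ∣ (y.val : ℤ) := hdvd
    have h2 : q ∣ y.val := by exact_mod_cast h1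
    have h3 : y.val < q := ZMod.val_lt y
    have h4 : y.val = 0 := Nat.eq_zero_of_dvd_of_lt h2 h3
    exact hy ((ZMod.val_eq_zero y).mp h4)
  have hBt : ¬ (q : ℤ) ∣ (2 * B + 1 : ℕ) * t := by
    intro hdvd
    have hcop : IsCoprime (q : ℤ) ((2 * B + 1 : ℕ) : ℤ) :=
      Nat.isCoprime_iff_coprime.mpr hc.coprime.symm
    exact htq (hcop.dvd_of_dvd_mul_left hdvd)
  rw [qdft_boundedUniformAmp_eq hc.lt.le, ← hyt, norm_mul, norm_mul, Complex.norm_real, Complex.norm_real,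
    Real.norm_of_nonneg (by positivity), Real.norm_of_nonneg (by positivity)]
  have key := sin_pi_div_le_norm_windowSum hq htq hBt (B := B)
  have hc0 : (0 : ℝ) ≤ (1 / Real.sqrt q) * (1 / Real.sqrt (2 * B + 1)) := by positivity
  calc Real.sin (π / q) * ((1 / Real.sqrt q) * (1 / Real.sqrt (2 * B + 1)))
      = (1 / Real.sqrt q) * (1 / Real.sqrt (2 * B + 1)) * Real.sin (π / q) := by ring
    _ ≤ (1 / Real.sqrt q) * (1 / Real.sqrt (2 * B + 1)) * ‖∑ k ∈ Finset.range (2 * B + 1),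
          (ZMod.stdAddChar ((((k : ℤ) - B : ℤ) : ZMod q) * (t : ZMod q)) : ℂ)‖ :=
        mul_le_mul_of_nonneg_left key hc0

omit [NeZero q] in
/-- The printed constant: `√(1/(q(2B+1))) · (1/q) ≤ sin(π/q) · (1/√q) · (1/√(2B+1))` (from `sin(π/q) > 1/q`).
[cite: ChenLiuZhandry2021, Cor 39 (proof)] -/
theorem cor39EtaBound_le_sinBound {B : ℕ} (hq : 2 ≤ q) :
    cor39EtaBound q B ≤ Real.sin (π / q) * ((1 / Real.sqrt q) * (1 / Real.sqrt (2 * B + 1))) := by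
  unfold cor39EtaBound
  have hq0 : (0 : ℝ) < q := by exact_mod_cast (by omega : 0 < q)
  have hB0 : (0 : ℝ) < 2 * B + 1 := by positivity
  have hsq : Real.sqrt (1 / ((q : ℝ) * (2 * B + 1))) = (1 / Real.sqrt q) * (1 / Real.sqrt (2 * B + 1)) := by
    rw [Real.sqrt_div' _ (by positivity), Real.sqrt_one, Real.sqrt_mul hq0.le]
    field_simp
  rw [hsq, mul_comm]
  exact mul_le_mul_of_nonneg_right (one_div_lt_sin_pi_div hq).le (by positivity)

/-- At zero the DFT is even larger: `√(1/(q(2B+1)))·(1/q) ≤ |f̂(0)| = √(2B+1)/√q`. [cite: ChenLiuZhandry2021, Cor 39 (proof)] -/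
theorem cor39EtaBound_le_norm_qdft_zero {B : ℕ} (hc : Cor10Conditions q B) :
    cor39EtaBound q B ≤ ‖qdft q (boundedUniformAmp q B) 0‖ := by
  have hq : 2 ≤ q := by have := hc.lt; omega
  have hq0 : (0 : ℝ) < q := by exact_mod_cast (by omega : 0 < q)
  have hB1 : (1 : ℝ) ≤ 2 * B + 1 := by
    have : (0 : ℝ) ≤ B := by positivity
    linarith
  rw [qdft_boundedUniformAmp_zero hc.lt.le, Complex.norm_real, Real.norm_of_nonneg (by positivity)]
  unfold cor39EtaBound
  have hsq : Real.sqrt (1 / ((q : ℝ) * (2 * B + 1))) = (1 / Real.sqrt q) * (1 / Real.sqrt (2 * B + 1)) := by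
    rw [Real.sqrt_div' _ (by positivity), Real.sqrt_one, Real.sqrt_mul hq0.le]
    field_simp
  rw [hsq]
  have hsB : 1 ≤ Real.sqrt (2 * B + 1) := Real.one_le_sqrt.mpr hB1
  have hsq1 : 1 ≤ Real.sqrt q := Real.one_le_sqrt.mpr (by exact_mod_cast (by omega : 1 ≤ q))
  have hq1 : (1 : ℝ) ≤ q := by exact_mod_cast (by omega : 1 ≤ q)
  have hsqpos : 0 < Real.sqrt q := by positivity
  have hsBpos : 0 < Real.sqrt (2 * B + 1) := by positivity
  -- LHS ≤ 1/√q · 1 · 1 ≤ √(2B+1)/√q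
  calc (1 / Real.sqrt q) * (1 / Real.sqrt (2 * B + 1)) * (1 / (q : ℝ))
      ≤ (1 / Real.sqrt q) * 1 * 1 := by
        apply mul_le_mul (mul_le_mul_of_nonneg_left _ (by positivity)) _ (by positivity) (by positivity)
        · rw [div_le_one hsBpos]; exact hsB
        · rw [div_le_one hq0]; exact hq1
    _ = 1 / Real.sqrt q := by ring
    _ ≤ Real.sqrt (2 * B + 1) / Real.sqrt q := by
        rw [div_le_div_iff_of_pos_right hsqpos]; exact hsB

/-- **Cor 39, the eta floor** («Therefore η = min_y |f̂(y)| ≥ √(1/(q(2B+1))) · (1/q)»).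
[cite: ChenLiuZhandry2021, Cor 39 (proof, p. 21)] -/
theorem cor39EtaBound_le_eta {B : ℕ} (hc : Cor10Conditions q B) :
    cor39EtaBound q B ≤ eta q (boundedUniformAmp q B) := by
  have hq : 2 ≤ q := by have := hc.lt; omega
  unfold eta
  rw [Finset.le_inf'_iff]
  intro y _
  by_cases hy : y = 0
  · rw [hy]; exact cor39EtaBound_le_norm_qdft_zero hc
  · exact (cor39EtaBound_le_sinBound hq).trans (norm_qdft_boundedUniformAmp_ge hc hy)

omit [NeZero q] in
/-- The eta floor is positive. [cite: ChenLiuZhandry2021, Cor 39 (proof)] -/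
theorem cor39EtaBound_pos {B : ℕ} (hq : 1 ≤ q) : 0 < cor39EtaBound q B := by
  unfold cor39EtaBound
  have hq0 : (0 : ℝ) < q := by exact_mod_cast (by omega : 0 < q)
  positivity

end DFT

/-! ### Plugging the eta floor into Thm 9 (the last line of the proof of Cor 39) -/

/-- `n·q/η²` is antitone in `η > 0`. [cite: ChenLiuZhandry2021, Thm 9] -/
theorem thm9SampleGrowth_antitone {n q : ℕ} {η η' : ℝ} (hη : 0 < η) (h : η ≤ η') :
    thm9SampleGrowth n q η' ≤ thm9SampleGrowth n q η := by
  unfold thm9SampleGrowth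
  have hn : (0 : ℝ) ≤ (n : ℝ) * q := by positivity
  apply div_le_div_of_nonneg_left hn (by positivity)
  exact pow_le_pow_left₀ hη.le h 2

/-- At the printed eta floor, Thm 9's sample growth IS Cor 10's: `n·q / (√(1/(q(2B+1)))·(1/q))² = n·q⁴·(2B+1)`.
[cite: ChenLiuZhandry2021, Cor 39 (proof, «The corollary follows by plugging η ≥ … in Theorem 35»)] -/
theorem thm9SampleGrowth_cor39EtaBound {n q B : ℕ} (hq : 1 ≤ q) :
    thm9SampleGrowth n q (cor39EtaBound q B) = cor10SampleGrowth n q B := by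
  unfold thm9SampleGrowth cor39EtaBound cor10SampleGrowth
  have hq0 : (0 : ℝ) < q := by exact_mod_cast (by omega : 0 < q)
  have hB0 : (0 : ℝ) < 2 * B + 1 := by positivity
  rw [mul_pow, Real.sq_sqrt (by positivity)]
  field_simp

/-- **Cor 10 from Thm 9**: under the side conditions of Cor 10, every `η` at least the true minimum
`η(f) ≥ √(1/(q(2B+1)))·(1/q)` needs at most Cor 10's sample growth: `n·q/η(f)² ≤ n·q⁴·(2B+1)`.
[cite: ChenLiuZhandry2021, Cor 10; Cor 39 (proof)] -/
theorem thm9SampleGrowth_eta_le_cor10 {n q B : ℕ} [NeZero q] (hc : Cor10Conditions q B) :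
    thm9SampleGrowth n q (eta q (boundedUniformAmp q B)) ≤ cor10SampleGrowth n q B := by
  have hq : 1 ≤ q := by have := hc.lt; omega
  rw [← thm9SampleGrowth_cor39EtaBound hq]
  exact thm9SampleGrowth_antitone (cor39EtaBound_pos hq) (cor39EtaBound_le_eta hc)

/-! ### Sanity of the other printed functions -/

/-- Thm 2's bound `β = (q−c)/2` is below the trivial `q/2` of Remark 3 by exactly `c/2`.
[cite: ChenLiuZhandry2021, Thm 2, Remark 3] -/
theorem thm2NormBound_eq (q c : ℕ) : thm2NormBound q c = (q : ℝ) / 2 - c / 2 := by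
  unfold thm2NormBound; ring

/-- The Thm 2/5/11 sample growth is at least `q · log q · n^c` once `q − c ≥ 1` (so polynomial but LARGE in `n` for the
printed constant `c`). [cite: ChenLiuZhandry2021, Thm 2 («m is a large polynomial»)] -/
theorem thm2SampleGrowth_ge {c n q : ℕ} (hcq : c + 1 ≤ q) (hq : 1 ≤ q) :
    (n : ℝ) ^ c * q * Real.log q ≤ thm2SampleGrowth c n q := by
  unfold thm2SampleGrowth
  have h1 : (1 : ℝ) ≤ (q : ℝ) - c := by
    have : (c : ℝ) + 1 ≤ q := by exact_mod_cast hcq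
    linarith
  have hlog : 0 ≤ Real.log q := Real.log_nonneg (by exact_mod_cast hq)
  have hbase : 0 ≤ (n : ℝ) ^ c * q * Real.log q := by positivity
  calc (n : ℝ) ^ c * q * Real.log q = 1 * ((n : ℝ) ^ c * q * Real.log q) := by ring
    _ ≤ ((q : ℝ) - c) ^ 3 * ((n : ℝ) ^ c * q * Real.log q) :=
        mul_le_mul_of_nonneg_right (one_le_pow₀ h1) hbase
    _ = ((q : ℝ) - c) ^ 3 * (n : ℝ) ^ c * q * Real.log q := by ring

/-- Cor 10's sample growth dominates `n · q⁴`. [cite: ChenLiuZhandry2021, Cor 10] -/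
theorem cor10SampleGrowth_ge (n q B : ℕ) : (n : ℝ) * (q : ℝ) ^ 4 ≤ cor10SampleGrowth n q B := by
  unfold cor10SampleGrowth
  have h1 : (1 : ℝ) ≤ 2 * B + 1 := by
    have : (0 : ℝ) ≤ B := by positivity
    linarith
  have h0 : (0 : ℝ) ≤ (n : ℝ) * (q : ℝ) ^ 4 := by positivity
  calc (n : ℝ) * (q : ℝ) ^ 4 = (n : ℝ) * (q : ℝ) ^ 4 * 1 := by ring
    _ ≤ (n : ℝ) * (q : ℝ) ^ 4 * (2 * B + 1) := mul_le_mul_of_nonneg_left h1 h0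

end CLZ22

end Literature.Computability.Cryptography
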